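import Mathlib
import Summits.Ventures.HodgeRepro.Tier4.Target
import Summits.Ventures.HodgeRepro.Tier4.Line3.Defs
import Summits.Ventures.HodgeRepro.Tier4.Line3.DefsLemmas
import Summits.Ventures.HodgeRepro.Tier4.Line3.KMDatum
import Summits.Ventures.HodgeRepro.Tier4.Line3.KMDatumS
import Summits.Ventures.HodgeRepro.Tier4.Line3.HeckeEquivarianceLemmas
import Summits.Ventures.HodgeRepro.Tier4.Line3.KernelIntegralPosS
import Summits.Ventures.HodgeRepro.Tier4.Line3.BallCoordLemmas
import Summits.Ventures.HodgeRepro.Tier4.Line3.UnitCopyScaling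
import Summits.Ventures.HodgeRepro.Tier4.Line3.UnitCopyPos
import Summits.Ventures.HodgeRepro.Tier4.Line3.CopyRemainder
import Summits.Ventures.HodgeRepro.Tier4.Line3.GaussRatioFormula

/-!
# Tier4/Line3/ArchCopyNecessary — what `ArchCopyBound` FORCES on the centre: the single-copy necessary condition (F1)

Blind re-derivation cell `pub-hodge-repro`, Tier 4 «PROVE THE STEP», LINE L3, seat t4-x2 (g3, reserve wall-breaker; bus
S13860 (F1)–(F2), confirmed first-hand by both critics S13871 / S13875).  The archimedean count `ArchCopyBound D S xm c θ₁`
(CopyRemainder p682977) bounds the SUM of the copies' weights by `θ₁ · Re I_∞(xm)`; every single non-main copy is therefore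
bounded by it (`weight_le_of_archCopyBound`), and for a SYMMETRIC copy `ε = (ε₀, ε₁, ε₀, ε₁)` the weight is EXACTLY
`‖Λ(o)‖ · exp(−π defSize ε xm) · I_∞(ε • xm)` with `I_∞(ε • xm) = ∫_𝔹 kernel (ε • xm) > 0` (the copy's own kernel is
`|wedge|²`, positive by `kernel_integral_pos_of_coordsS` on the SAME `J`-positive plane as the centre).  Hence
(`exp_neg_defSize_le_of_archCopyBound`)

  `exp(−π · defSize ε xm) · ‖Λ(o)‖ · I_∞(ε • xm) ≤ θ₁ · Re I_∞(xm)`: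

when a definite size of the scalar is `< 1` (`defSize < 0`, e.g. a unit with `‖σ₁ u‖ < 1`, the others `≤ 1`), the left side
carries `exp(+π |defSize|)`, growing with the definite size of the centre — the amplification of (F1) as a kernel
statement: `ArchCopyBound` with any fixed `θ₁` is INCOMPATIBLE with a centre whose definite sizes are large relative to
the `τ₀`-data (the «definite-deep centre» of proofs/t4/L3/SATURATION-SCALAR-FAMILY-x2.md §9 (c)), and is a PROFILE
condition of the centre against the admissible scalars (proofs/t4/L3/ARCH-COPY-PROFILE-x2.md §3).  Non-mainness of the copy
(`o ≠ main`) is a hypothesis here (for a scalar with `c ε₀ · ε₀ ≠ 1` it holds — the Gram diagonal is an orbit invariant —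
but that is not needed for the inequality).

Nothing here says anything about the status of the Hodge conjecture for CM abelian varieties, which is NOT proved
(HC_CM is NOT proved by anyone in this repository).
-/

set_option autoImplicit false

noncomputable section

namespace Summit.Ventures.HodgeRepro.Tier4.Line3

open Summit.Ventures.HodgeRepro.Tier4
open Matrix NumberField MeasureTheory
open scoped ComplexConjugate
open scoped Classical

namespace T4Data

variable (X : T4Data)

/-- The weight of a copy is non-negative. -/
theorem weight_nonneg_copy {D : X.ThetaData} {S : Set (Fin 4 → X.E)} {xm : X.Tuple} (c : X.CopyData D S xm)
    (o : X.Orbit) : 0 ≤ c.weight o :=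
  mul_nonneg (mul_nonneg (norm_nonneg _) (norm_nonneg _)) (X.gaussRatio_pos _ _).le

/-- **EVERY SINGLE NON-MAIN COPY IS BOUNDED BY THE COUNT**: under `ArchCopyBound … θ₁`, `weight c o ≤ θ₁ · Re I_∞(xm)`. -/
theorem weight_le_of_archCopyBound {D : X.ThetaData} {S : Set (Fin 4 → X.E)} {xm : X.Tuple} {c : X.CopyData D S xm}
    {θ₁ : ℝ} (h : X.ArchCopyBound D S xm c θ₁) {o : X.Orbit} (ho : o ∈ X.Copies S xm)
    (hne : o ≠ X.orbitOf (X.lines xm)) : c.weight o ≤ θ₁ * (∫ z in ball, X.kernel D.Φ xm z).re := by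
  obtain ⟨hs, hsum⟩ := h
  have h1 : (if o ∈ X.Copies S xm ∧ o ≠ X.orbitOf (X.lines xm) then c.weight o else 0) ≤
      ∑' o', (if o' ∈ X.Copies S xm ∧ o' ≠ X.orbitOf (X.lines xm) then c.weight o' else 0) := by
    refine hs.le_tsum o fun o' _ => ?_
    split_ifs
    · exact X.weight_nonneg_copy c o'
    · exact le_rfl
  rw [if_pos ⟨ho, hne⟩] at h1
  exact h1.trans hsum

/-- The Gaussian ratio exceeds `1` exactly when the definite size decreases (`defSize < 0`). -/
theorem one_lt_gaussRatio_iff (ε : Fin 4 → X.E) (x : X.Tuple) : 1 < X.gaussRatio ε x ↔ X.defSize ε x < 0 := by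
  rw [X.gaussRatio_eq_exp, Real.one_lt_exp_iff]
  constructor <;> intro h <;> nlinarith [Real.pi_pos]

/-- The kernel of a symmetric copy `(ε₀ • a, ε₁ • b, ε₀ • a, ε₁ • b)` is the square modulus of the scaled wedge. -/
theorem kernel_copy_symm (Φ : KMDatumS) (ε : Fin 4 → X.E) (xm : X.Tuple) (h02 : xm 2 = xm 0) (h13 : xm 3 = xm 1)
    (e02 : ε 2 = ε 0) (e13 : ε 3 = ε 1) (z : Fin 2 → ℂ) :
    X.kernel Φ (fun j => ε j • xm j) z =
      wedge (datumS Φ (X.τ₀ (ε 0) • X.ballCoord (xm 0)) z) (datumS Φ (X.τ₀ (ε 1) • X.ballCoord (xm 1)) z) *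
        conj (wedge (datumS Φ (X.τ₀ (ε 0) • X.ballCoord (xm 0)) z)
          (datumS Φ (X.τ₀ (ε 1) • X.ballCoord (xm 1)) z)) := by
  unfold T4Data.kernel
  simp only [h02, h13, e02, e13, X.ballCoord_smul]

/-- **THE COPY'S OWN ARCHIMEDEAN INTEGRAL IS POSITIVE** for a symmetric copy of a centre whose first two ball vectors span
a `J`-positive plane with a non-vanishing wedge somewhere (the hypotheses of L3.7 `kernel_integral_pos_of_coordsS`, which
the scaled vectors inherit: the plane is the same, the wedge is a positive multiple). -/
theorem kernel_integral_copy_pos (Φ : KMDatumS) (ε : Fin 4 → X.E) (xm : X.Tuple) (h02 : xm 2 = xm 0)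
    (h13 : xm 3 = xm 1) (e02 : ε 2 = ε 0) (e13 : ε 3 = ε 1) (hε : ∀ j, ε j ≠ 0)
    (hab : ∃ z ∈ ball, wedge (datumS Φ (X.ballCoord (xm 0)) z) (datumS Φ (X.ballCoord (xm 1)) z) ≠ 0)
    (hpos : ∀ u v : ℂ, (u ≠ 0 ∨ v ≠ 0) →
      0 < (star (u • X.ballCoord (xm 0) + v • X.ballCoord (xm 1)) ⬝ᵥ
        (J *ᵥ (u • X.ballCoord (xm 0) + v • X.ballCoord (xm 1)))).re) :
    IntegrableOn (fun z => X.kernel Φ (fun j => ε j • xm j) z) ball ∧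
      0 < (∫ z in ball, X.kernel Φ (fun j => ε j • xm j) z).re := by
  have ht0 : X.τ₀ (ε 0) ≠ 0 := (map_ne_zero _).2 (hε 0)
  have ht1 : X.τ₀ (ε 1) ≠ 0 := (map_ne_zero _).2 (hε 1)
  -- the scaled wedge is a positive multiple of the wedge
  have hab' : ∃ z ∈ ball, wedge (datumS Φ (X.τ₀ (ε 0) • X.ballCoord (xm 0)) z)
      (datumS Φ (X.τ₀ (ε 1) • X.ballCoord (xm 1)) z) ≠ 0 := by
    obtain ⟨z, hz, hw⟩ := hab
    refine ⟨z, hz, ?_⟩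
    have h0 : ∀ k, datumS Φ (X.τ₀ (ε 0) • X.ballCoord (xm 0)) z k =
        ((‖X.τ₀ (ε 0)‖ ^ 2 * Real.exp (-(Real.pi * ((‖X.τ₀ (ε 0)‖ ^ 2 - 1) * maj (X.ballCoord (xm 0)) z))) : ℝ) : ℂ) *
          datumS Φ (X.ballCoord (xm 0)) z k := fun k => datumS_smul_complex Φ _ _ z k
    have h1 : ∀ k, datumS Φ (X.τ₀ (ε 1) • X.ballCoord (xm 1)) z k =
        ((‖X.τ₀ (ε 1)‖ ^ 2 * Real.exp (-(Real.pi * ((‖X.τ₀ (ε 1)‖ ^ 2 - 1) * maj (X.ballCoord (xm 1)) z))) : ℝ) : ℂ) *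
          datumS Φ (X.ballCoord (xm 1)) z k := fun k => datumS_smul_complex Φ _ _ z k
    have hw' : wedge (datumS Φ (X.τ₀ (ε 0) • X.ballCoord (xm 0)) z) (datumS Φ (X.τ₀ (ε 1) • X.ballCoord (xm 1)) z) =
        (((‖X.τ₀ (ε 0)‖ ^ 2 * Real.exp (-(Real.pi * ((‖X.τ₀ (ε 0)‖ ^ 2 - 1) * maj (X.ballCoord (xm 0)) z))) : ℝ) : ℂ) *
          ((‖X.τ₀ (ε 1)‖ ^ 2 * Real.exp (-(Real.pi * ((‖X.τ₀ (ε 1)‖ ^ 2 - 1) * maj (X.ballCoord (xm 1)) z))) : ℝ) : ℂ)) *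
          wedge (datumS Φ (X.ballCoord (xm 0)) z) (datumS Φ (X.ballCoord (xm 1)) z) := by
      unfold wedge
      rw [h0 0, h0 1, h1 0, h1 1]
      ring
    rw [hw']
    refine mul_ne_zero (mul_ne_zero ?_ ?_) hw
    · exact Complex.ofReal_ne_zero.2 (datum_scale_pos ht0 _ z).ne'
    · exact Complex.ofReal_ne_zero.2 (datum_scale_pos ht1 _ z).ne'
  -- the scaled vectors span the same plane
  have hpos' : ∀ u v : ℂ, (u ≠ 0 ∨ v ≠ 0) →
      0 < (star (u • (X.τ₀ (ε 0) • X.ballCoord (xm 0)) + v • (X.τ₀ (ε 1) • X.ballCoord (xm 1))) ⬝ᵥ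
        (J *ᵥ (u • (X.τ₀ (ε 0) • X.ballCoord (xm 0)) + v • (X.τ₀ (ε 1) • X.ballCoord (xm 1))))).re := by
    intro u v huv
    have := hpos (u * X.τ₀ (ε 0)) (v * X.τ₀ (ε 1)) (by
      rcases huv with hu | hv
      · exact Or.inl (mul_ne_zero hu ht0)
      · exact Or.inr (mul_ne_zero hv ht1))
    simpa only [smul_smul] using this
  have key := kernel_integral_pos_of_coordsS Φ (X.τ₀ (ε 0) • X.ballCoord (xm 0)) (X.τ₀ (ε 1) • X.ballCoord (xm 1))
    hab' hpos'
  have hfun : (fun z => X.kernel Φ (fun j => ε j • xm j) z) = fun z =>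
      wedge (datumS Φ (X.τ₀ (ε 0) • X.ballCoord (xm 0)) z) (datumS Φ (X.τ₀ (ε 1) • X.ballCoord (xm 1)) z) *
        conj (wedge (datumS Φ (X.τ₀ (ε 0) • X.ballCoord (xm 0)) z)
          (datumS Φ (X.τ₀ (ε 1) • X.ballCoord (xm 1)) z)) := by
    funext z
    exact X.kernel_copy_symm Φ ε xm h02 h13 e02 e13 z
  rw [hfun]
  exact key

/-- The weight of a symmetric copy is EXACTLY `‖Λ(o)‖ · gaussRatio · Re I_∞(ε • xm)` (its own kernel is `|wedge|² ≥ 0`). -/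
theorem weight_eq_of_symm {D : X.ThetaData} {S : Set (Fin 4 → X.E)} {xm : X.Tuple} (c : X.CopyData D S xm) (o : X.Orbit)
    (h02 : xm 2 = xm 0) (h13 : xm 3 = xm 1) (e02 : c.rep o 2 = c.rep o 0) (e13 : c.rep o 3 = c.rep o 1) :
    c.weight o = (∫ z in ball, X.kernel D.Φ (fun j => c.rep o j • xm j) z).re *
      ‖c.lam o 0 * c.lam o 1 * conj (c.lam o 2 * c.lam o 3)‖ * X.gaussRatio (c.rep o) xm := by
  unfold CopyData.weight
  congr 2
  -- the scaled kernel is the copy's kernel, a non-negative real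
  have hk : (fun z => ((X.kernelScale (c.rep o) xm z : ℝ) : ℂ) * X.kernel D.Φ xm z) =
      fun z => X.kernel D.Φ (fun j => c.rep o j • xm j) z := by
    funext z
    exact (X.kernel_smul_family D.Φ (c.rep o) xm z).symm
  rw [hk]
  have hre : ∀ z, X.kernel D.Φ (fun j => c.rep o j • xm j) z =
      ((Complex.normSq (wedge (datumS D.Φ (X.τ₀ (c.rep o 0) • X.ballCoord (xm 0)) z)
        (datumS D.Φ (X.τ₀ (c.rep o 1) • X.ballCoord (xm 1)) z)) : ℝ) : ℂ) := by
    intro z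
    rw [X.kernel_copy_symm D.Φ (c.rep o) xm h02 h13 e02 e13 z, Complex.mul_conj]
  simp_rw [hre, integral_complex_ofReal, Complex.ofReal_re, Complex.norm_real]
  rw [Real.norm_of_nonneg (integral_nonneg fun z => Complex.normSq_nonneg _)]

/-- **THE NECESSARY CONDITION (F1) AS A KERNEL STATEMENT.** Under `ArchCopyBound D S xm c θ₁`, for a symmetric non-main
copy with non-zero scalars of a centre satisfying L3.7's positivity hypotheses:
`exp(−π · defSize ε xm) · ‖Λ(o)‖ · Re I_∞(ε • xm) ≤ θ₁ · Re I_∞(xm)`, with `Re I_∞(ε • xm) > 0`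
(`kernel_integral_copy_pos`).  When `defSize ε xm < 0` the left side is `exp(+π |defSize|) · ‖Λ(o)‖ · Re I_∞(ε • xm)`. -/
theorem exp_neg_defSize_le_of_archCopyBound {D : X.ThetaData} {S : Set (Fin 4 → X.E)} {xm : X.Tuple}
    {c : X.CopyData D S xm} {θ₁ : ℝ} (h : X.ArchCopyBound D S xm c θ₁) {o : X.Orbit} (ho : o ∈ X.Copies S xm)
    (hne : o ≠ X.orbitOf (X.lines xm)) (h02 : xm 2 = xm 0) (h13 : xm 3 = xm 1) (e02 : c.rep o 2 = c.rep o 0)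
    (e13 : c.rep o 3 = c.rep o 1) :
    Real.exp (-(Real.pi * X.defSize (c.rep o) xm)) * ‖c.lam o 0 * c.lam o 1 * conj (c.lam o 2 * c.lam o 3)‖ *
      (∫ z in ball, X.kernel D.Φ (fun j => c.rep o j • xm j) z).re ≤ θ₁ * (∫ z in ball, X.kernel D.Φ xm z).re := by
  have h1 := X.weight_le_of_archCopyBound h ho hne
  rw [X.weight_eq_of_symm c o h02 h13 e02 e13, X.gaussRatio_eq_exp] at h1
  calc Real.exp (-(Real.pi * X.defSize (c.rep o) xm)) * ‖c.lam o 0 * c.lam o 1 * conj (c.lam o 2 * c.lam o 3)‖ *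
        (∫ z in ball, X.kernel D.Φ (fun j => c.rep o j • xm j) z).re
      = (∫ z in ball, X.kernel D.Φ (fun j => c.rep o j • xm j) z).re *
        ‖c.lam o 0 * c.lam o 1 * conj (c.lam o 2 * c.lam o 3)‖ * Real.exp (-(Real.pi * X.defSize (c.rep o) xm)) := by
          ring
    _ ≤ θ₁ * (∫ z in ball, X.kernel D.Φ xm z).re := h1

/-- **THE AMPLIFICATION, QUANTIFIED**: with `defSize ε xm < 0` and a non-vanishing phase, `ArchCopyBound` forces
`exp(π · |defSize ε xm|) ≤ θ₁ · Re I_∞(xm) / (‖Λ(o)‖ · Re I_∞(ε • xm))` — a bound on the definite sizes of the centre in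
terms of the `τ₀`-integrals and `θ₁`; a definite-deep centre (large `defQuad σ (xm j)` at a `σ` with `‖σ ε_j‖ < 1`)
violates it. -/
theorem exp_abs_defSize_le_of_archCopyBound {D : X.ThetaData} {S : Set (Fin 4 → X.E)} {xm : X.Tuple}
    {c : X.CopyData D S xm} {θ₁ : ℝ} (h : X.ArchCopyBound D S xm c θ₁) {o : X.Orbit} (ho : o ∈ X.Copies S xm)
    (hne : o ≠ X.orbitOf (X.lines xm)) (h02 : xm 2 = xm 0) (h13 : xm 3 = xm 1) (e02 : c.rep o 2 = c.rep o 0)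
    (e13 : c.rep o 3 = c.rep o 1) (hΛ : 0 < ‖c.lam o 0 * c.lam o 1 * conj (c.lam o 2 * c.lam o 3)‖)
    (hI : 0 < (∫ z in ball, X.kernel D.Φ (fun j => c.rep o j • xm j) z).re) :
    Real.exp (Real.pi * |X.defSize (c.rep o) xm|) ≤ θ₁ * (∫ z in ball, X.kernel D.Φ xm z).re /
      (‖c.lam o 0 * c.lam o 1 * conj (c.lam o 2 * c.lam o 3)‖ *
        (∫ z in ball, X.kernel D.Φ (fun j => c.rep o j • xm j) z).re) ∨ 0 ≤ X.defSize (c.rep o) xm := by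
  by_cases hd : 0 ≤ X.defSize (c.rep o) xm
  · exact Or.inr hd
  · left
    have hneg : X.defSize (c.rep o) xm < 0 := lt_of_not_ge hd
    have h1 := X.exp_neg_defSize_le_of_archCopyBound h ho hne h02 h13 e02 e13
    rw [abs_of_neg hneg]
    rw [le_div_iff₀ (mul_pos hΛ hI)]
    calc Real.exp (Real.pi * -X.defSize (c.rep o) xm) *
          (‖c.lam o 0 * c.lam o 1 * conj (c.lam o 2 * c.lam o 3)‖ *
            (∫ z in ball, X.kernel D.Φ (fun j => c.rep o j • xm j) z).re)
        = Real.exp (-(Real.pi * X.defSize (c.rep o) xm)) * ‖c.lam o 0 * c.lam o 1 * conj (c.lam o 2 * c.lam o 3)‖ *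
          (∫ z in ball, X.kernel D.Φ (fun j => c.rep o j • xm j) z).re := by
            rw [show Real.pi * -X.defSize (c.rep o) xm = -(Real.pi * X.defSize (c.rep o) xm) by ring]
            ring
      _ ≤ θ₁ * (∫ z in ball, X.kernel D.Φ xm z).re := h1

end T4Data

end Summit.Ventures.HodgeRepro.Tier4.Line3

end
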